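import Summits.AnomalousDissipation.AnomalousDissipation.Theorems.UniformResolution.Negative.RowBarrierAtoms

/-!
# Negative knowledge for the crux `UniformResolution` (stmt-AnomalousDissipation-14330), X-b:
# the ROW BARRIER, part 2 — the four-atom LEAK LAW: both rows vanish exactly, the budgets are level-uniform

Standing disprover, generation 2 (refuter-cdisprove-stmt-AnomalousDissipation-14330-g2-0, cycle 1). Supports
stmt-AnomalousDissipation-14330; no route-item statement is asserted. At every level `m + 2`, for the shear force
`f_ν = S_{1,4π²ν} = 4π²ν cos(2πx₁)e₀` (laminar state `S_{1,1}`):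

* `leakLaw m = p_A δ_{[S_{1,1/2}]} + p_C δ_{[S_{1,−1/4}]} + (8(m+2)²)⁻¹ δ_{[S_{m+2,1}]} + p_0 δ_0` (weights of part 1);
* it is a probability law carried by level-`(m+2)` fields in the unit ball, mean energy `≤ 1`, mean enstrophy
  `p_Aπ²/2 + p_Cπ²/8 + π²/4 ≤ π²` (the cutoff atom carries the FIXED quantum `π²/4`), dissipation `≥ π²ν/4` — LOUD
  uniformly in the level;
* `leakLaw_energyRow`, `leakLaw_fgtRow`, `isFGTStationary_leakLaw`: the ENERGY ROW and the FGT ROW (the single row of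
  S3 `stub_weightedH2` / `Negative/FGTBound.lean`) VANISH EXACTLY, at every `ν`;
* `leakLaw_enstrophyRow`: the PLAIN enstrophy row equals `π⁴ν(1 − (m+2)²)` — violated at rate `(m+2)²`: the row that
  would bound the mean palinstrophy (and resolve the family) is exactly the one whose vortex-stretching term has no
  `N`-uniform closure for genuine ensembles; the FGT weight that tames the stretching is blind to where the enstrophy sits.
-/

namespace Summit.AnomalousDissipation.AnomalousDissipation.Theorems.UniformResolution.Negative

open MeasureTheory Filter Topology
open scoped ENNReal InnerProductSpace RealInnerProductSpace
open Literature.Analysis.FunctionSpaces Literature.Analysis.FluidPDE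
open Summit.AnomalousDissipation.AnomalousDissipation.Theorems.QuarticGate.Negative
open Summit.AnomalousDissipation.AnomalousDissipation.Theorems
open Summit.AnomalousDissipation.AnomalousDissipation.Theorems.ResolvedDissipation.Negative
  (shearFreq shearSet shearField shearState shearField_mul shearField_zero neg_mem_shearSet freqNormSq_of_mem_shearSet
    ne_zero_of_mem_shearSet card_shearSet isSmooth_shearField isDivFree_shearField hasZeroMean_shearField
    convect_shearField_self coe_shearState_ae isLevel_shearState norm_sq_shearState eGradNormSq_shearState
    eGradNormSq_fourierTruncate_shearState mFourierCoeff_shearField_eq_zero integral_norm_sq_shearField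
    isTransversal_kolCoeff_shearSet fourierTruncate_shearField eGradNormSq_zero fourierTruncate_congr_ae)

noncomputable section

/-- Local notation for the real Hilbert space `L²(T³; ℝ³)`. -/
local notation "L2T3" => Lp (EuclideanSpace ℝ (Fin 3)) 2 (volume : Measure (UnitAddTorus (Fin 3)))

section Leak

/-- `m + 2 ≠ 0` (the level of the cutoff atom). [folklore] -/
theorem leakLevel_ne_zero (m : ℕ) : m + 2 ≠ 0 := by omega

/-- The four atoms at level `m + 2`: production `[S_{1,1/2}]`, low consumption `[S_{1,−1/4}]`, cutoff `[S_{m+2,1}]`,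
null `[S_{1,0}] = 0`. -/
def leakAtom (m : ℕ) : Fin 4 → Torus.energySpace (Fin 3) :=
  ![shearState 1 one_ne_zero (1 / 2), shearState 1 one_ne_zero (-(1 / 4)), shearState (m + 2) (leakLevel_ne_zero m) 1,
    shearState 1 one_ne_zero 0]

/-- **THE LEAK LAW at level `m + 2`** (viscosity-independent as a measure; the force scales with `ν`). -/
def leakLaw (m : ℕ) : Measure (Torus.energySpace (Fin 3)) := atomic (leakWeight m) (leakAtom m)

/-- The force of the barrier: `f_ν = 4π²ν cos(2πx₁)e₀ = S_{1,4π²ν}` (its laminar state is `S_{1,1}`). -/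
def leakForce (ν : ℝ) : UnitAddTorus (Fin 3) → EuclideanSpace ℝ (Fin 3) := shearField 1 (4 * Real.pi ^ 2 * ν)

/-! ### The law: probability, level, support, budgets -/

/-- The leak law is a probability law. [folklore] -/
instance isProbabilityMeasure_leakLaw (m : ℕ) : IsProbabilityMeasure (leakLaw m) :=
  isProbabilityMeasure_atomic _ _ (leakWeight_nonneg m) (sum_leakWeight m)

/-- Atom `0` is the production atom `[S_{1,1/2}]`. [folklore] -/
theorem leakAtom_zero (m : ℕ) : leakAtom m 0 = shearState 1 one_ne_zero (1 / 2) := rfl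
/-- Atom `1` is the low consumption atom `[S_{1,−1/4}]`. [folklore] -/
theorem leakAtom_one (m : ℕ) : leakAtom m 1 = shearState 1 one_ne_zero (-(1 / 4)) := rfl
/-- Atom `2` is the cutoff atom `[S_{m+2,1}]`. [folklore] -/
theorem leakAtom_two (m : ℕ) : leakAtom m 2 = shearState (m + 2) (leakLevel_ne_zero m) 1 := rfl
/-- Atom `3` is the null atom `[S_{1,0}] = 0`. [folklore] -/
theorem leakAtom_three (m : ℕ) : leakAtom m 3 = shearState 1 one_ne_zero 0 := rfl

/-- Every atom is a level-`(m+2)` field. [folklore] -/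
theorem isLevel_leakAtom (m : ℕ) (i : Fin 4) : IsLevel (m + 2) (leakAtom m i) := by
  fin_cases i
  · exact isLevel_shearState one_ne_zero _ (by omega)
  · exact isLevel_shearState one_ne_zero _ (by omega)
  · exact isLevel_shearState (leakLevel_ne_zero m) _ le_rfl
  · exact isLevel_shearState one_ne_zero _ (by omega)

/-- Every atom lies in the unit ball. [folklore] -/
theorem norm_leakAtom_le (m : ℕ) (i : Fin 4) : ‖leakAtom m i‖ ≤ 1 := by
  have key : ∀ (M : ℕ) (hM : M ≠ 0) (a : ℝ), a ^ 2 ≤ 2 → ‖shearState M hM a‖ ≤ 1 := fun M hM a ha => by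
    have h := norm_sq_shearState hM a
    nlinarith [norm_nonneg (shearState M hM a)]
  fin_cases i
  · exact key 1 one_ne_zero _ (by norm_num)
  · exact key 1 one_ne_zero _ (by norm_num)
  · exact key (m + 2) (leakLevel_ne_zero m) _ (by norm_num)
  · exact key 1 one_ne_zero _ (by norm_num)

/-- The leak law is carried by level-`(m+2)` fields. [folklore] -/
theorem ae_isLevel_leakLaw (m : ℕ) : ∀ᵐ u ∂(leakLaw m), IsLevel (m + 2) u :=
  ae_atomic _ _ (isLevel_leakAtom m)

/-- The leak law is supported in the unit ball. [folklore] -/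
theorem ae_norm_le_leakLaw (m : ℕ) : ∀ᵐ u ∂(leakLaw m), ‖u‖ ≤ 1 :=
  ae_atomic _ _ (norm_leakAtom_le m)

/-- Mean energy of the leak law is at most `1`. [folklore] -/
theorem ensembleEnergy_leakLaw_le (m : ℕ) : Torus.ensembleEnergy (leakLaw m) ≤ 1 := by
  rw [leakLaw, ensembleEnergy_atomic _ _ (leakWeight_nonneg m)]
  calc ∑ i, leakWeight m i * ‖leakAtom m i‖ ^ 2 ≤ ∑ i, leakWeight m i * 1 := by
        refine Finset.sum_le_sum fun i _ => mul_le_mul_of_nonneg_left ?_ (leakWeight_nonneg m i)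
        have h := norm_leakAtom_le m i
        nlinarith [norm_nonneg (leakAtom m i)]
    _ = 1 := by rw [← Finset.sum_mul, sum_leakWeight, one_mul]

/-- Enstrophies of the four atoms: `π²/2`, `π²/8`, `2π²(m+2)²`, `0`. [folklore] -/
theorem eGradNormSq_leakAtom (m : ℕ) :
    Torus.eGradNormSq (((leakAtom m 0).1 : L2T3) : UnitAddTorus (Fin 3) → EuclideanSpace ℝ (Fin 3)) =
        ENNReal.ofReal (Real.pi ^ 2 / 2) ∧
      Torus.eGradNormSq (((leakAtom m 1).1 : L2T3) : UnitAddTorus (Fin 3) → EuclideanSpace ℝ (Fin 3)) =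
        ENNReal.ofReal (Real.pi ^ 2 / 8) ∧
      Torus.eGradNormSq (((leakAtom m 2).1 : L2T3) : UnitAddTorus (Fin 3) → EuclideanSpace ℝ (Fin 3)) =
        ENNReal.ofReal (2 * Real.pi ^ 2 * ((m + 2 : ℕ) : ℝ) ^ 2) ∧
      Torus.eGradNormSq (((leakAtom m 3).1 : L2T3) : UnitAddTorus (Fin 3) → EuclideanSpace ℝ (Fin 3)) = 0 := by
  refine ⟨?_, ?_, ?_, ?_⟩
  · rw [leakAtom_zero, eGradNormSq_shearState]; congr 1; push_cast; ring
  · rw [leakAtom_one, eGradNormSq_shearState]; congr 1; push_cast; ring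
  · rw [leakAtom_two, eGradNormSq_shearState]; congr 1; push_cast; ring
  · rw [leakAtom_three, eGradNormSq_shearState]; simp

/-- **Mean enstrophy of the leak law**: `p_A π²/2 + p_C π²/8 + π²/4` (the cutoff atom contributes the FIXED quantum
`π²/4` at every level). [folklore] -/
theorem ensembleEnstrophy_leakLaw (m : ℕ) :
    Torus.ensembleEnstrophy (leakLaw m) =
      ENNReal.ofReal (leakMassA m * (Real.pi ^ 2 / 2) + leakMassC m * (Real.pi ^ 2 / 8) + Real.pi ^ 2 / 4) := by
  obtain ⟨e0, e1, e2, e3⟩ := eGradNormSq_leakAtom m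
  rw [leakLaw, ensembleEnstrophy_atomic]
  simp only [Fin.sum_univ_four, e0, e1, e2, e3, mul_zero, add_zero]
  simp only [leakWeight, Matrix.cons_val_zero, Matrix.cons_val_one, Matrix.cons_val]
  have hA := (leakMassA_pos m).le
  have hC := (leakMassC_pos m).le
  have hB := (leakMassB_pos m).le
  have hpi : 0 ≤ Real.pi ^ 2 := by positivity
  rw [← ENNReal.ofReal_mul hA, ← ENNReal.ofReal_mul hC, ← ENNReal.ofReal_mul hB,
    ← ENNReal.ofReal_add (by positivity) (by positivity), ← ENNReal.ofReal_add (by positivity) (by positivity)]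
  congr 1
  have hq : leakMassB m * (2 * Real.pi ^ 2 * ((m + 2 : ℕ) : ℝ) ^ 2) = Real.pi ^ 2 / 4 := by
    unfold leakMassB
    have : ((m + 2 : ℕ) : ℝ) ≠ 0 := by positivity
    field_simp
    ring
  rw [hq]

/-- Mean enstrophy bound, `n`-uniform: `≤ π²`. [folklore] -/
theorem ensembleEnstrophy_leakLaw_le (m : ℕ) : Torus.ensembleEnstrophy (leakLaw m) ≤ ENNReal.ofReal (Real.pi ^ 2) := by
  rw [ensembleEnstrophy_leakLaw]
  refine ENNReal.ofReal_le_ofReal ?_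
  have h1 := leakMassC_le m
  have hpi : 0 < Real.pi ^ 2 := by positivity
  unfold leakMassA
  nlinarith

/-- **LOUD, uniformly in the level**: dissipation `≥ π²ν/4` (`ν ≥ 0`). [folklore] -/
theorem ensembleDissipation_leakLaw_ge (m : ℕ) {ν : ℝ} (hν : 0 ≤ ν) :
    Real.pi ^ 2 / 4 * ν ≤ Torus.ensembleDissipation ν (leakLaw m) := by
  unfold Torus.ensembleDissipation
  have hA := (leakMassA_pos m).le
  have hC := (leakMassC_pos m).le
  have hpi : 0 ≤ Real.pi ^ 2 := by positivity
  rw [ensembleEnstrophy_leakLaw, ENNReal.toReal_ofReal (by positivity)]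
  nlinarith [mul_nonneg hA hpi, mul_nonneg hC hpi]

/-! ### The two rows vanish exactly -/

/-- The barrier force is smooth. [folklore] -/
theorem isSmooth_leakForce (ν : ℝ) : Torus.IsSmooth (leakForce ν) := isSmooth_shearField 1 _
/-- The barrier force is divergence-free. [folklore] -/
theorem isDivFree_leakForce (ν : ℝ) : Torus.IsDivFree (leakForce ν) := isDivFree_shearField 1 _
/-- The barrier force has zero mean. [folklore] -/
theorem hasZeroMean_leakForce (ν : ℝ) : Torus.HasZeroMean (leakForce ν) := hasZeroMean_shearField one_ne_zero _

/-- The energy rows of the four atoms: `π²ν/2`, `−5π²ν/8`, `−2π²ν(m+2)²`, `0`. [folklore] -/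
theorem energyRow_leakAtom (ν : ℝ) (m : ℕ) :
    Torus.nsGeneratorPairing ν (leakForce ν) (leakAtom m 0) (trunc (m + 2) (leakAtom m 0)) = Real.pi ^ 2 * ν / 2 ∧
      Torus.nsGeneratorPairing ν (leakForce ν) (leakAtom m 1) (trunc (m + 2) (leakAtom m 1)) = -(5 * Real.pi ^ 2 * ν / 8) ∧
      Torus.nsGeneratorPairing ν (leakForce ν) (leakAtom m 2) (trunc (m + 2) (leakAtom m 2)) =
        -(2 * Real.pi ^ 2 * ν * ((m + 2 : ℕ) : ℝ) ^ 2) ∧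
      Torus.nsGeneratorPairing ν (leakForce ν) (leakAtom m 3) (trunc (m + 2) (leakAtom m 3)) = 0 := by
  have hm1 : m + 2 ≠ 1 := by omega
  refine ⟨?_, ?_, ?_, ?_⟩
  · rw [leakAtom_zero, leakForce, energyRow_shearState one_ne_zero _ ν _ (by omega), if_pos rfl]; push_cast; ring
  · rw [leakAtom_one, leakForce, energyRow_shearState one_ne_zero _ ν _ (by omega), if_pos rfl]; push_cast; ring
  · rw [leakAtom_two, leakForce, energyRow_shearState _ _ ν _ le_rfl, if_neg hm1]; ring
  · rw [leakAtom_three, leakForce, energyRow_shearState one_ne_zero _ ν _ (by omega), if_pos rfl]; push_cast; ring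

/-- The plain enstrophy rows of the four atoms: `4π²M²` times the energy rows. [folklore] -/
theorem enstrophyRow_leakAtom (ν : ℝ) (m : ℕ) :
    Torus.nsGeneratorPairing ν (leakForce ν) (leakAtom m 0) (lapTrunc (m + 2) (leakAtom m 0)) = 2 * Real.pi ^ 4 * ν ∧
      Torus.nsGeneratorPairing ν (leakForce ν) (leakAtom m 1) (lapTrunc (m + 2) (leakAtom m 1)) =
        -(5 * Real.pi ^ 4 * ν / 2) ∧
      Torus.nsGeneratorPairing ν (leakForce ν) (leakAtom m 2) (lapTrunc (m + 2) (leakAtom m 2)) =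
        -(8 * Real.pi ^ 4 * ν * ((m + 2 : ℕ) : ℝ) ^ 4) ∧
      Torus.nsGeneratorPairing ν (leakForce ν) (leakAtom m 3) (lapTrunc (m + 2) (leakAtom m 3)) = 0 := by
  have hm1 : m + 2 ≠ 1 := by omega
  refine ⟨?_, ?_, ?_, ?_⟩
  · rw [leakAtom_zero, leakForce, enstrophyRow_shearState one_ne_zero _ ν _ (by omega), if_pos rfl]; push_cast; ring
  · rw [leakAtom_one, leakForce, enstrophyRow_shearState one_ne_zero _ ν _ (by omega), if_pos rfl]; push_cast; ring
  · rw [leakAtom_two, leakForce, enstrophyRow_shearState _ _ ν _ le_rfl, if_neg hm1]; ring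
  · rw [leakAtom_three, leakForce, enstrophyRow_shearState one_ne_zero _ ν _ (by omega), if_pos rfl]; push_cast; ring

/-- The FGT weights of the four atoms: `w_A`, `w_C`, `w_B`, `1`. [folklore] -/
theorem fgtWeight_leakAtom (m : ℕ) :
    fgtWeight (m + 2) (leakAtom m 0) = wA ∧ fgtWeight (m + 2) (leakAtom m 1) = wC ∧
      fgtWeight (m + 2) (leakAtom m 2) = wB m ∧ fgtWeight (m + 2) (leakAtom m 3) = 1 := by
  refine ⟨?_, ?_, ?_, ?_⟩
  · rw [leakAtom_zero, fgtWeight_shearState one_ne_zero _ (by omega), wA]; push_cast; ring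
  · rw [leakAtom_one, fgtWeight_shearState one_ne_zero _ (by omega), wC]; push_cast; ring
  · rw [leakAtom_two, fgtWeight_shearState _ _ le_rfl, wB]; ring
  · rw [leakAtom_three, fgtWeight_shearState one_ne_zero _ (by omega)]; simp

/-- **THE ENERGY ROW OF THE LEAK LAW VANISHES** (production `p_A π²ν/2` = consumption `5p_C π²ν/8 + π²ν/4`). [folklore] -/
theorem leakLaw_energyRow (ν : ℝ) (m : ℕ) :
    Integrable (fun u => Torus.nsGeneratorPairing ν (leakForce ν) u (trunc (m + 2) u)) (leakLaw m) ∧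
      ∫ u, Torus.nsGeneratorPairing ν (leakForce ν) u (trunc (m + 2) u) ∂(leakLaw m) = 0 := by
  refine ⟨integrable_atomic _ _ _, ?_⟩
  obtain ⟨r0, r1, r2, r3⟩ := energyRow_leakAtom ν m
  rw [leakLaw, integral_atomic _ _ (leakWeight_nonneg m)]
  simp only [Fin.sum_univ_four, r0, r1, r2, r3, mul_zero, add_zero]
  simp only [leakWeight, Matrix.cons_val_zero, Matrix.cons_val_one, Matrix.cons_val]
  have h := (leak_rows_system m).1
  have hq := leakMassB_mul_sq m
  linear_combination (Real.pi ^ 2 * ν / 8) * h - (2 * Real.pi ^ 2 * ν) * hq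

/-- **THE FGT ROW OF THE LEAK LAW VANISHES** (`2p_A w_A = (5/2)p_C w_C + e_m`). [folklore] -/
theorem leakLaw_fgtRow (ν : ℝ) (m : ℕ) :
    Integrable (fun u => fgtWeight (m + 2) u *
        Torus.nsGeneratorPairing ν (leakForce ν) u (lapTrunc (m + 2) u)) (leakLaw m) ∧
      ∫ u, fgtWeight (m + 2) u * Torus.nsGeneratorPairing ν (leakForce ν) u (lapTrunc (m + 2) u) ∂(leakLaw m) = 0 := by
  refine ⟨integrable_atomic _ _ _, ?_⟩
  obtain ⟨r0, r1, r2, r3⟩ := enstrophyRow_leakAtom ν m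
  obtain ⟨w0, w1, w2, w3⟩ := fgtWeight_leakAtom m
  rw [leakLaw, integral_atomic _ _ (leakWeight_nonneg m)]
  simp only [Fin.sum_univ_four, r0, r1, r2, r3, w0, w1, w2, w3, mul_zero, add_zero]
  simp only [leakWeight, Matrix.cons_val_zero, Matrix.cons_val_one, Matrix.cons_val]
  have h := (leak_rows_system m).2
  have hq := leakMassB_mul_sq m
  have he : leakE m = ((m + 2 : ℕ) : ℝ) ^ 2 * wB m := rfl
  rw [he] at h
  linear_combination (Real.pi ^ 4 * ν / 2) * h - (8 * Real.pi ^ 4 * ν * ((m + 2 : ℕ) : ℝ) ^ 2 * wB m) * hq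

/-- **The leak law is FGT-STATIONARY** at level `m + 2` (the single row of S3 `stub_weightedH2` / `Negative/FGTBound.lean`),
for every `ν`. [folklore] -/
theorem isFGTStationary_leakLaw (ν : ℝ) (m : ℕ) : IsFGTStationary ν (leakForce ν) (m + 2) (leakLaw m) :=
  ⟨inferInstance, ⟨1, ae_norm_le_leakLaw m⟩, ae_isLevel_leakLaw m, leakLaw_fgtRow ν m⟩

/-- **The PLAIN enstrophy row is violated at rate `π⁴ν((m+2)² − 1)`**: unweighted, the cutoff atom's palinstrophy deficit
`−ν‖Δū‖²` is fully visible. This is the row that would bound the mean palinstrophy (hence resolve the family) — and the one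
whose stretching term has no `N`-uniform closure for genuine Galerkin ensembles. [folklore] -/
theorem leakLaw_enstrophyRow (ν : ℝ) (m : ℕ) :
    ∫ u, Torus.nsGeneratorPairing ν (leakForce ν) u (lapTrunc (m + 2) u) ∂(leakLaw m) =
      Real.pi ^ 4 * ν * (1 - ((m + 2 : ℕ) : ℝ) ^ 2) := by
  obtain ⟨r0, r1, r2, r3⟩ := enstrophyRow_leakAtom ν m
  rw [leakLaw, integral_atomic _ _ (leakWeight_nonneg m)]
  simp only [Fin.sum_univ_four, r0, r1, r2, r3, mul_zero, add_zero]
  simp only [leakWeight, Matrix.cons_val_zero, Matrix.cons_val_one, Matrix.cons_val]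
  have h := (leak_rows_system m).1
  have hq := leakMassB_mul_sq m
  linear_combination (Real.pi ^ 4 * ν / 2) * h - (8 * Real.pi ^ 4 * ν * ((m + 2 : ℕ) : ℝ) ^ 2) * hq

end Leak

end

end Summit.AnomalousDissipation.AnomalousDissipation.Theorems.UniformResolution.Negative
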